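import Summits.BirchSwinnertonDyer.Rank1Residual.X2.ResidualDevissageMultiplicative
import Summits.BirchSwinnertonDyer.Rank1Residual.X2.CongruentLambdaShiftDerived
import Summits.BirchSwinnertonDyer.Rank1Residual.X2.GreenbergVatsalReductionDatumCard
import HarnessLib

/-!
# Greenberg–Vatsal 2000, §2 display (16) AT A GOOD ORDINARY (ANOMALOUS ALLOWED) EISENSTEIN PRIME —
# the `E`-side of GV Thm. (1.3) in its PRINTED setting, by the gen-16 devissage run VERBATIM on
# Greenberg's reduction datum (cell `b2b-bsdres`, unit `b2b-bsdres-eisenstein-p2`, gen 19;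
# X2-GAP §21.6 (iii) / §23.3: "the kernel route of gens 11–16 can now be completed symmetrically")

HONEST FRAMING (run/shared/lean/b2b/bsd-rank1-residual/, verbatim in every file): the goal of the
cell is to DELETE the COMBINATION-SHAPED residual classes of the Birch–Swinnerton-Dyer formula for
ALL analytic-rank `≤ 1` elliptic curves over `ℚ` — "full BSD formula for every rank `≤ 1` curve in
class `C`" assembled STRICTLY from published theorems — so that the rank-`≤ 1` remainder becomes
exactly the CONSTRUCTION-SHAPED classes, which are TYPED (missing-input `Prop`s), NOT attempted.
This is not "finishing BSD". Research route; NO CLAIM BEYOND STATED CLASSES; nothing here changes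
a label (X1's GV-parity cells are COVERED by the PRINTED GV Thm. (1.3); this file re-derives its
`E`-side in the kernel, it books nothing). Theorems only: no definition, no named fact.

WHAT. Gen 16 proved GV display (16) — `#H¹(ℚ_Σ/ℚ_∞, Φ₀)·#S^{Σ₀}_{E[p]/Φ₀}(ℚ_∞) = p^{λ(E)+Σδ(+e_p)}` —
at a MULTIPLICATIVE Eisenstein prime for the TATE datum (`ResidualDevissageMultiplicative`). The
devissage itself (`ResidualDevissageLine.natCard_gvSelmer_torsion_eq_mul_of_line`) is stated for ANY
Greenberg data whose graded piece is `I_p`-trivial and whose residual line has order `p`; the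
`E(ℚ_∞)[p^∞]`-correction (`GreenbergVatsalTorsionCurve.natCard_gvSelmer_torsion_curve`) likewise.
With gen 9's `reductionData_htriv`, gen 19's `natCard_reductionData_plus_inf_torsionBy` (`#C_p[p] = p`
at good ordinary `p`), gen 11's count `natCard_gvSelmerInfty_inf_torsionBy_eq_pow`
(`#(S^{Σ₀}_{E[p^∞]}(ℚ_∞) ⊓ H¹[p]) = p^{λ+Σδ}`, from A115/A116 and GV p. 26 `hGV`) and the tree's Mazur
6.12 (`mem_fixedPoints_kerSubgroup_iff_of_isCyclotomic`), the same three lines give display (16) at a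
GOOD ORDINARY prime — the setting in which Greenberg–Vatsal print it (§2 pp. 28–30):

* `fixedPoints_kerSubgroup_eq_bot_of_line_goodOrd` — `E(ℚ_∞)[p^∞] = 0` in GV's first case (rational
  line ramified at `p` and even) at an odd good ordinary `p`;
* `natCard_fixedPoints_quot_eq_one_of_line_goodOrd` — the Prop. (2.8) correction factor is `1`;
* **`natCard_line_mul_quotSelmer_eq_of_goodOrd`** — `#H¹(ℚ_Σ/ℚ_∞, Φ₀) · #S^{Σ₀}_{E[p]/Φ₀}(ℚ_∞) =
  p^{λ(E) + Σ_{v∈Σ₀} δ_v}` for `μ(E) = 0`, granted the printed GV §1–§2 facts A115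
  (`lambda_nonPrimitive_eq_add_sum_delta`), A116 (`divisible_nonPrimitiveSelmerInfty_of_mu_eq_zero`),
  GV p. 26 / Greenberg Props. 2.2–2.4 (`imKummer_ge_greenbergCondition_at_p`), and the lifting property
  (GV p. 30, `H²(ℚ_Σ/ℚ_∞, Φ) = 0`).

So the `E`-dependent half of GV Thm. (1.3) is a kernel theorem in BOTH settings (good ordinary /
multiplicative) from the same devissage; the X2a reading of the multiplicative case (flag
`GV00-mult-asserted`) rests on nothing that is not also used verbatim in the printed case.
References: [GreenbergVatsal2000] §2 pp. 25–30, display (16), Prop. (2.8); [GreenbergLNM1716] §1 p. 62,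
§2 pp. 70–75, §3 p. 86; HOME/b2b-bsdres-eisenstein-p2/X2-GAP.md §21, §24.
-/

noncomputable section

open scoped Classical AddSubgroup

namespace Summit.BirchSwinnertonDyer.Rank1Residual.X2.ResidualDevissageGoodOrdinary

open NumberField IsDedekindDomain Field WeierstrassCurve Literature.NumberTheory.GaloisRepresentations
  Literature.NumberTheory.EllipticCurves Literature.NumberTheory.EllipticCurves.GreenbergSelmer
  Literature.NumberTheory.EllipticCurves.GreenbergVatsal2000 IsDedekindDomain.HeightOneSpectrum
  Literature.NumberTheory.EllipticCurves.Rank1Residual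
  Summit.BirchSwinnertonDyer.Rank1Residual.X2.GreenbergVatsalTorsion
  Summit.BirchSwinnertonDyer.Rank1Residual.X2.GreenbergVatsalReductionDatum
  Summit.BirchSwinnertonDyer.Rank1Residual.X2.CongruentLambdaShiftDerived
  Summit.BirchSwinnertonDyer.Rank1Residual.X2.ResidualDevissageModules
  Summit.BirchSwinnertonDyer.Rank1Residual.X2.ResidualDevissageSelmer
  Summit.BirchSwinnertonDyer.Rank1Residual.X2.ResidualDevissageLine
  Summit.BirchSwinnertonDyer.Rank1Residual.X2.ResidualDevissageNoTorsion

variable (W : WeierstrassCurve ℚ) [W.IsGloballyMinimal] [W.IsElliptic] (p : ℕ) [hp : Fact p.Prime]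
  (κ : ZpExtension ℚ p) {γ : absoluteGaloisGroup ℚ} (S₀ : Finset (HeightOneSpectrum (𝓞 ℚ)))
  {Φ₀ : AddSubgroup (W.geomTorsion (p : ℤ))} (hΦ : IsRationalLine W p Φ₀)

/-! ## §1. `E(ℚ_∞)[p^∞] = 0` in GV's first case at a good ordinary prime -/

include hΦ in
/-- **`E(ℚ_∞)[p^∞] = 0` in Greenberg–Vatsal's first case at an odd GOOD ORDINARY `p`** (`Φ₀` a
rational line ramified at `p` and even; `κ` cyclotomic): by Mazur 6.12 (tree
`mem_fixedPoints_kerSubgroup_iff_of_isCyclotomic`) a point of `E(ℚ_∞)[p^∞]` is `Γ_ℚ`-fixed, and a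
`Γ_ℚ`-fixed element of `E[p^∞]` vanishes in case 1 (gen 16
`ResidualDevissageNoTorsion.eq_zero_of_forall_smul_eq_primary`). [cite: GreenbergVatsal2000, §2 Prop. (2.8), p. 28]
[cite: GreenbergLNM1716, §1 p. 62; §3 p. 86] -/
theorem fixedPoints_kerSubgroup_eq_bot_of_line_goodOrd (hp2 : p ≠ 2)
    (hgood : W.HasGoodReductionAtPrime p) (hord : ¬ (p : ℤ) ∣ W.frobeniusTrace p)
    (hκ : κ.IsCyclotomic) (hram : ¬ LineUnramifiedAt W p Φ₀) (heven : LineEven W p Φ₀) :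
    (FixedPoints.addSubgroup κ.kerSubgroup (W.geomPrimaryTorsion p) :
      AddSubgroup (W.geomPrimaryTorsion p)) = ⊥ := by
  rw [eq_bot_iff]
  intro b hb
  rw [AddSubgroup.mem_bot]
  exact ResidualDevissageNoTorsion.eq_zero_of_forall_smul_eq_primary W p hΦ hp2 hram heven b
    ((W.mem_fixedPoints_kerSubgroup_iff_of_isCyclotomic κ hp2 hgood hord hκ _).mp hb)

include hΦ in
/-- **The correction factor of Prop. (2.8) is `1`** in GV's first case at an odd good ordinary `p`:
`#(E(ℚ_∞)[p^∞] / p·E(ℚ_∞)[p^∞]) = 1`. [cite: GreenbergVatsal2000, §2 Prop. (2.8), p. 28] -/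
theorem natCard_fixedPoints_quot_eq_one_of_line_goodOrd (hp2 : p ≠ 2)
    (hgood : W.HasGoodReductionAtPrime p) (hord : ¬ (p : ℤ) ∣ W.frobeniusTrace p)
    (hκ : κ.IsCyclotomic) (hram : ¬ LineUnramifiedAt W p Φ₀) (heven : LineEven W p Φ₀) :
    Nat.card (FixedPoints.addSubgroup κ.kerSubgroup (W.geomPrimaryTorsion p) ⧸
        (nsmulAddMonoidHom
          (α := FixedPoints.addSubgroup κ.kerSubgroup (W.geomPrimaryTorsion p)) p).range) = 1 := by
  have hbot := fixedPoints_kerSubgroup_eq_bot_of_line_goodOrd W p κ hΦ hp2 hgood hord hκ hram heven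
  haveI : Subsingleton (FixedPoints.addSubgroup κ.kerSubgroup (W.geomPrimaryTorsion p)) := by
    rw [hbot]
    infer_instance
  haveI : Subsingleton (FixedPoints.addSubgroup κ.kerSubgroup (W.geomPrimaryTorsion p) ⧸
      (nsmulAddMonoidHom
        (α := FixedPoints.addSubgroup κ.kerSubgroup (W.geomPrimaryTorsion p)) p).range) :=
    Quot.Subsingleton
  exact Nat.card_of_subsingleton 0

/-! ## §2. Display (16) at a good ordinary prime: the `E`-side identity -/

include hΦ in
/-- **GV (16) at an odd GOOD ORDINARY (possibly anomalous) Eisenstein prime, `E`-side:**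
`#H¹(ℚ_Σ/ℚ_∞, Φ₀) · #S^{Σ₀}_{E[p]/Φ₀}(ℚ_∞) = p^{λ(E) + Σ_{v∈Σ₀} δ_v}`
for a rational line `Φ₀` ramified at `p` and even, `μ(E) = 0`, `Σ₀ ∌ p` finite containing the bad
primes — from the devissage of gen 16 run on Greenberg's reduction datum `C_p = ker(E[p^∞] → Ẽ)`
(`I_p`-trivial graded piece: gen 9; `#C_p[p] = p`: gen 19), the count
`#(S^{Σ₀}_{E[p^∞]}(ℚ_∞) ⊓ H¹[p]) = p^{λ+Σδ}` (gen 11, from A115 `hA`, A116 `hB`, GV p. 26 `hGV`), the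
`E(ℚ_∞)[p^∞]`-corrected Prop. (2.8) (gen 8) with correction `1` (§1), and the lifting property
`hlift` (GV p. 30). The printed setting of GV Thm. (1.3). [cite: GreenbergVatsal2000, §2 pp. 25–30 (display (16)), Prop. (2.8)]
[cite: GreenbergLNM1716, §1 p. 62, §2 pp. 70–75] -/
theorem natCard_line_mul_quotSelmer_eq_of_goodOrd
    (hGV : imKummer_ge_greenbergCondition_at_p) (hA : lambda_nonPrimitive_eq_add_sum_delta)
    (hB : divisible_nonPrimitiveSelmerInfty_of_mu_eq_zero)
    (hκ : κ.IsCyclotomic) (hγ : κ.IsTopGenerator γ) (hp2 : p ≠ 2)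
    (hgood : W.HasGoodReductionAtPrime p) (hord : ¬ (p : ℤ) ∣ W.frobeniusTrace p)
    (hΔ : ¬ (p : ℤ) ∣ minimalDiscriminantInt W)
    (hS₀ : ∀ v ∈ S₀, ((p : ℕ) : 𝓞 ℚ) ∉ v.asIdeal)
    (hS : ∀ v : HeightOneSpectrum (𝓞 ℚ), v ∉ S₀ → ((p : ℕ) : 𝓞 ℚ) ∉ v.asIdeal →
      W.HasGoodReductionAt v)
    (D : W.SelmerDualData κ γ) [Module.Finite (IwasawaAlgebra p) D.X] (hX : D.IsTorsion)
    (hμ : D.mu = 0) (hram : ¬ LineUnramifiedAt W p Φ₀) (heven : LineEven W p Φ₀)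
    (hlift : ∀ s ∈ ResidualDevissageSelmer.quotSelmer κ.kerSubgroup
        (ResidualDevissageLine.lineSub Φ₀ hΦ).Quot p (↑S₀ : Set (HeightOneSpectrum (𝓞 ℚ))),
      ∃ x ∈ GreenbergVatsal2000.unramifiedOutside κ.kerSubgroup
          ↥((↥(W.geomPrimaryTorsion p))[(p : ℤ)]) p (↑S₀ : Set (HeightOneSpectrum (𝓞 ℚ))),
        ResidualDevissageSelmer.subH1 κ.kerSubgroup (ResidualDevissageLine.lineSub Φ₀ hΦ).proj
          (ResidualDevissageLine.lineSub Φ₀ hΦ).proj_smul x = s) :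
    Nat.card (GreenbergVatsal2000.unramifiedOutside κ.kerSubgroup
        (ResidualDevissageLine.lineSub Φ₀ hΦ).Sub p (↑S₀ : Set (HeightOneSpectrum (𝓞 ℚ)))) *
      Nat.card (ResidualDevissageSelmer.quotSelmer κ.kerSubgroup
        (ResidualDevissageLine.lineSub Φ₀ hΦ).Quot p (↑S₀ : Set (HeightOneSpectrum (𝓞 ℚ)))) =
    p ^ (lambdaInvariant p D.X + ∑ v ∈ S₀, delta W p v) := by
  have hS' : ∀ v : HeightOneSpectrum (𝓞 ℚ), v ∉ (↑S₀ : Set (HeightOneSpectrum (𝓞 ℚ))) →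
      ((p : ℕ) : 𝓞 ℚ) ∉ v.asIdeal → W.HasGoodReductionAt v :=
    fun v hv hpv ↦ hS v (fun h ↦ hv (Finset.mem_coe.2 h)) hpv
  obtain ⟨c, hc⟩ := exists_isComplexConjugation (Rat.castHom ℝ)
  have hdev := ResidualDevissageLine.natCard_gvSelmer_torsion_eq_mul_of_line hΦ hp2 hram heven
    (reductionData W p hΔ) (reductionData_htriv W p hΔ)
    (natCard_reductionData_plus_inf_torsionBy W p hΔ hord) (↑S₀ : Set (HeightOneSpectrum (𝓞 ℚ)))
    hS' κ.kerSubgroup (ResidualDevissageLine.mem_kerSubgroup_of_isComplexConjugation κ hc) hc hlift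
  have h28 := GreenbergVatsalTorsionCurve.natCard_gvSelmer_torsion_curve W p κ.kerSubgroup
    (reductionData W p hΔ) (↑S₀ : Set (HeightOneSpectrum (𝓞 ℚ))) hS' (reductionData_htriv W p hΔ)
  rw [← hdev, h28, natCard_fixedPoints_quot_eq_one_of_line_goodOrd W p κ hΦ hp2 hgood hord hκ hram
    heven, mul_one]
  change Nat.card ↥(gvSelmerInfty κ (W.geomPrimaryTorsion p) (reductionData W p hΔ) ↑S₀ ⊓ _) = _
  exact natCard_gvSelmerInfty_inf_torsionBy_eq_pow W S₀ hGV hA hB hp2 hgood hord hκ hγ hS₀ hS D hX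
    hμ hΔ

end Summit.BirchSwinnertonDyer.Rank1Residual.X2.ResidualDevissageGoodOrdinary

end
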